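/-
Copyright (c) 2026 the pub-hodgecm-mathlib formalisation cell (harness21).  Prover seat hodgecm-mathlib-K2E3-p14 (g10) (E3 hand on strike line L1; LEAD F0P6-plan (g16)
BATCH #267 (2) (i) + #269 (2) DEDUP FLAG), Track B «K2-LIT» ∕ hLiu418 = `stmt-HodgeConjecture-24832`: U1-glob LEVEL 2-fin ∕ block D ∕ K1-a♮ «ARCH-CONT» — the
SIGNATURE LETTERS OF THE FRAMED RANK-ONE CORNER INDEX `h_w(σ·E_bb) = −2·(T_w)₂₂·σ_w(σ·E_bb)·(T_w⁻¹)₁₁` in the closed-form Shimura frame of record: hermitian,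
`det = 0`, `≠ 0`, semidefinite of either sign — the THIN ADAPTER from ★ p864832 (LH4-p17) `framedIndex_single_of_shimuraFrame` to ★ p864788's binder names
`hsd hdet0 hne`.  THEOREMS ONLY (no `def` ∕ `instance` ∕ notation ∕ named-fact hypothesis ∕ `sorry`, default heartbeats).
-/
import Summits.HodgeConjecture.HodgeConjecture.Theorems.K2LiuKindOneSingularCornerIndexDatum   -- ★ p864832 (LH4-p17): `framedIndex_single_of_shimuraFrame`, `re_I_mul_ofReal_mul`, `im_I_mul_ofReal_mul`; brings ★ `re_embedding_eq_zero_of_complexConj_eq_neg`, ★ `hermTwo` (PosDef API)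
import Summits.HodgeConjecture.HodgeConjecture.Theorems.K2LiuHermitianTubeFrameArch              -- ★ `tw_ne_zero` (the frame parameters `t_k = Re σ_w(dV·dW)_k ≠ 0`)
import Mathlib.LinearAlgebra.Matrix.PosDef
import HarnessLib

/-!
# Crux `HLiu418`, U1-glob LEVEL 2-fin, arch branch — `K2LiuRankOneFramedCornerIndexLetters`: the signature letters `hsd hdet0 hne` (and `hherm`) of the framed
# rank-one corner index, BY NAME, in the closed-form Shimura frame of record

Cell `hodgecm-mathlib`, crux item hLiu418 = `stmt-HodgeConjecture-24832` (helper lane `--supports … --as helper`, count-neutral), route of record `HCCMUnconditional`;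
squad K2 ∕ E3, strike line L1, U1-glob LEVEL 2-fin, the archimedean branch; LEAD F0P6-plan (g16) BATCH #267 (2) (i) ∕ #269 (2); U1 desk K2E3-p28 (g4); K1a desk K2Liu-p01 (g11).

THE POINT.  ★ p864788 `K2LiuKindOneArchWhittakerLetterScalarType.hW1_scalarType_rankOne (hx) (hg) (hsd) (hdet0) (hne) (heb)` — the per-place archimedean Whittaker letter at
scalar type in the `x·n(r)·g` coordinates of the U1-arch `hAloc` clause of record (★ p864643 `hloc_archLetters_of_presentationLetters`) — takes its rank-one index
`hidx` ABSTRACTLY through three letters: `hsd : hidx.PosSemidef ∨ (−hidx).PosSemidef`, `hdet0 : hidx.det = 0`, `hne : hidx ≠ 0`.  At the record the index is the FRAMED CORNER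
INDEX `hidx w = −2·(T_w)₂₂·σ_w(single b b σ)·(T_w⁻¹)₁₁` of the dressed corner `σ·E_bb` (★ p863665 `exists_cornerDress`: `σ ≠ 0`, `c σ = −σ`) in the closed-form Shimura frame
(★ `exists_tubeFrame_arch₄` (x), letters `hTdef hTinvdef` BY VALUE: `T_w = (D D; C −C)`, `T_w⁻¹ = ½(D⁻¹ −C⁻¹; D⁻¹ C⁻¹)`, `D = diag √(|t_k|∕2)`, `C = diag(i·sgn t_k·√(|t_k|∕2))`,
`t_k = Re σ_w(dV·dW)_k ≠ 0` — ★ `tw_ne_zero`), and ★ p864832 (LH4-p17) `framedIndex_single_of_shimuraFrame` computes it in closed form: `hidx w = single b b (i·sgn(t_b)·σ_w σ)`,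
whose corner value `i·sgn(t_b)·σ_w σ = −sgn(t_b)·Im σ_w σ` is REAL (`Re σ_w σ = 0`, ★ `re_embedding_eq_zero_of_complexConj_eq_neg`) and non-zero.  THIS FILE is the thin adapter:
§1 the letters of a diagonal rank-one `2 × 2` matrix `single b b z` (`det = 0`; `≠ 0` iff `z ≠ 0`; hermitian and `PosSemidef ∨ (−·).PosSemidef` when `Im z = 0` — Mathlib
`Matrix.PosSemidef.diagonal`); §2 the four letters at LH4-p17's generic Shimura-frame currency (binders `(T Tinv) (t) (ht) (hTdef) (hTinvdef) (b)` byte-identical to ★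
`framedIndex_single_of_shimuraFrame`), plus the explicit real value and the two signed twins; §3 AT THE FRAME OF RECORD, per complex place `w` (★ arch₄'s `hTdef hTinvdef : ∀ w, …`
BY VALUE at `n = 2`, `t := fun k => Re σ_w(dV·dW)_k`, `ht := tw_ne_zero`): **`hsd_of_frame`, `hdet0_of_frame`, `hne_of_frame`, `hherm_of_frame`** keyed to ★ p864788's binder
names, so that `hAloc := fun r hr w => hW1_scalarType_rankOne k (hx w) (hg w) (hsd_of_frame … w) (hdet0_of_frame … w) (hne_of_frame … w) (heb w)` closes with no adapter, and
`eq_single_of_frame` (the explicit value `single b b (−sgn(t_b)·Im σ_w σ)`) for the sign readers of the (σ-A) road.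
[Shimura1997, §18.1 (18.4), §A3] [Shimura1982, §4 Thm. 4.2] [GelbartRogawski1991, §3.1 Prop. 3.1.1].
NOT HERE (no duplication): the explicit datum `(a_b, w σ)` with `‖det a_b‖ = 1` and the `±a·hermTwo(t,0,0)·aᴴ` twins — ★ p864832 `exists_cornerDatum_at_place` (LH4-p17), consumed
DIRECTLY by the `J·n·hfr`-coordinate readers (★ p864470 §0 `exists_localContinuation_of_scalarType`, K1a «ARCH-CONT», (D-arch-loc)); hermitian-ness for a general skew index —
★ `K2LiuKindWArchFramedIndexHermitian.framedIndex_conjTranspose_of_frame`; `det ≠ 0` for non-singular indices — ★ `framedIndex_det_ne_zero_of_frame`.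
HONEST LABEL.  Count-neutral helper; closes no socket by itself: `HC_CM` is proved only modulo the 7 printed citations (2 remaining named inputs: hLiu418 =
`stmt-HodgeConjecture-24832`, h413 = `stmt-HodgeConjecture-24833`) until rung 0 closes.

## References
* [Shimura1997] G. Shimura, *Euler Products and Eisenstein Series*, CBMS 93 (1997), §18.1 (18.4), §A3 (the index `h` of `e(tr(h b))` in the tube coordinates).
* [Shimura1982] G. Shimura, *Confluent hypergeometric functions on tube domains*, Math. Ann. 260 (1982), §4 Thm. 4.2 (the signature of the index decides the Γ-factors).
* [GelbartRogawski1991] S. Gelbart, J. Rogawski, *L-functions and Fourier–Jacobi coefficients for the unitary group U(3)*, Invent. Math. 105 (1991), §3.1 Prop. 3.1.1.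
-/

set_option autoImplicit false
set_option linter.dupNamespace false -- the mandated namespace repeats `HodgeConjecture.HodgeConjecture`

noncomputable section

open scoped Matrix ComplexConjugate ComplexOrder
open Complex Matrix NumberField NumberField.InfinitePlace IsDedekindDomain
open Literature.NumberTheory.Automorphic Literature.NumberTheory.Automorphic.UnitaryGroup Literature.NumberTheory.GaloisRepresentations
open Literature.NumberTheory.GelbartRogawski1991 Literature.NumberTheory.GelbartRogawski1991.GRConstruction

namespace Summit.HodgeConjecture.HodgeConjecture.Cruxes.HLiu418.K2LiuRankOneFramedCornerIndexLetters

open K2LiuKindOneSingularCornerIndexDatum (framedIndex_single_of_shimuraFrame re_I_mul_ofReal_mul im_I_mul_ofReal_mul)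
open K2LiuIncoherentRankOneSignJunction (re_embedding_eq_zero_of_complexConj_eq_neg)
open K2LiuHermitianTubeFrameArch (tw_ne_zero)

/-! ## §1 The letters of a diagonal rank-one `2 × 2` matrix `single b b z` -/

section Single

/-- `det (z·E_bb) = 0` for a `2 × 2` matrix unit on the diagonal. [folklore] -/
theorem det_single_diag_eq_zero (b : Fin 2) (z : ℂ) : (Matrix.single b b z).det = 0 := by
  rw [Matrix.det_fin_two]
  fin_cases b <;> simp

/-- `z·E_bb ≠ 0` for `z ≠ 0`. [folklore] -/
theorem single_diag_ne_zero (b : Fin 2) {z : ℂ} (hz : z ≠ 0) : Matrix.single b b z ≠ 0 := fun h =>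
  hz (by simpa using congr_fun (congr_fun h b) b)

/-- `z·E_bb` is hermitian for real `z`. [folklore] -/
theorem conjTranspose_single_diag_of_im_eq_zero (b : Fin 2) {z : ℂ} (hz : z.im = 0) : (Matrix.single b b z)ᴴ = Matrix.single b b z := by
  rw [Matrix.conjTranspose_single, Complex.star_def, Complex.conj_eq_iff_im.2 hz]

/-- `z·E_bb` is positive semidefinite for `0 ≤ z` (a diagonal matrix with non-negative entries, Mathlib `Matrix.PosSemidef.diagonal`). [folklore] -/
theorem posSemidef_single_diag_of_nonneg (b : Fin 2) {z : ℂ} (hz : 0 ≤ z) : (Matrix.single b b z).PosSemidef := by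
  rw [← Matrix.diagonal_single]
  exact Matrix.PosSemidef.diagonal (Pi.single_nonneg.2 hz)

/-- **semidefinite of either sign**: for real `z`, `z·E_bb` is positive semidefinite or negative semidefinite (by the sign of `z`). [folklore] -/
theorem posSemidef_single_diag_or_neg (b : Fin 2) {z : ℂ} (hz : z.im = 0) :
    (Matrix.single b b z).PosSemidef ∨ (-Matrix.single b b z).PosSemidef := by
  rcases le_total 0 z.re with h | h
  · exact Or.inl (posSemidef_single_diag_of_nonneg b (Complex.nonneg_iff.2 ⟨h, hz.symm⟩))
  · refine Or.inr ?_
    rw [Matrix.single_neg]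
    exact posSemidef_single_diag_of_nonneg b (Complex.nonneg_iff.2 ⟨by rw [Complex.neg_re]; linarith, by rw [Complex.neg_im, hz, neg_zero]⟩)

end Single

/-! ## §2 The letters of the framed corner index in the Shimura frame (LH4-p17's generic currency: `t : Fin 2 → ℝ`, `hTdef hTinvdef` BY VALUE) -/

section Frame

variable (T Tinv : Matrix (Fin 2 ⊕ Fin 2) (Fin 2 ⊕ Fin 2) ℂ) (t : Fin 2 → ℝ) (ht : ∀ i, t i ≠ 0)
  (hTdef : T = fromBlocks (diagonal (fun i => (Real.sqrt (|t i| / 2) : ℂ))) (diagonal (fun i => (Real.sqrt (|t i| / 2) : ℂ)))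
        (diagonal (fun i => I * (((t i / |t i|) * Real.sqrt (|t i| / 2) : ℝ) : ℂ))) (-diagonal (fun i => I * (((t i / |t i|) * Real.sqrt (|t i| / 2) : ℝ) : ℂ))))
  (hTinvdef : Tinv = fromBlocks (diagonal (fun i => (((Real.sqrt (|t i| / 2))⁻¹ / 2 : ℝ) : ℂ))) (-diagonal (fun i => I * (((Real.sqrt (|t i| / 2))⁻¹ * (t i / |t i|) / 2 : ℝ) : ℂ)))
        (diagonal (fun i => (((Real.sqrt (|t i| / 2))⁻¹ / 2 : ℝ) : ℂ))) (diagonal (fun i => I * (((Real.sqrt (|t i| / 2))⁻¹ * (t i / |t i|) / 2 : ℝ) : ℂ))))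

include ht hTdef hTinvdef

/-- **THE EXPLICIT REAL VALUE.**  For a purely imaginary corner value `x` (`Re x = 0`) the framed corner index is the REAL diagonal rank-one matrix
`−2·(T)₂₂·(x·E_bb)·(Tinv)₁₁ = (−sgn(t_b)·Im x)·E_bb` (★ p864832 `framedIndex_single_of_shimuraFrame` + `Re(i·s·x) = −s·Im x`, `Im(i·s·x) = s·Re x = 0`).
[cite: Shimura1997, §18.1 (18.4)] -/
theorem framedCornerIndex_eq_single_real (b : Fin 2) {x : ℂ} (hx : x.re = 0) :
    (-2 : ℂ) • (T.toBlocks₂₂ * Matrix.single b b x * Tinv.toBlocks₁₁) = Matrix.single b b ((-((t b / |t b|) * x.im) : ℝ) : ℂ) := by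
  rw [framedIndex_single_of_shimuraFrame T Tinv t ht hTdef hTinvdef b x]
  congr 1
  exact Complex.ext (by rw [re_I_mul_ofReal_mul, Complex.ofReal_re]) (by rw [im_I_mul_ofReal_mul, hx, mul_zero, Complex.ofReal_im])

/-- **HERMITIAN** (`hherm`): for `Re x = 0` the framed corner index is hermitian. [cite: Shimura1997, §18.1 (18.4), §A3] -/
theorem framedCornerIndex_conjTranspose (b : Fin 2) {x : ℂ} (hx : x.re = 0) :
    ((-2 : ℂ) • (T.toBlocks₂₂ * Matrix.single b b x * Tinv.toBlocks₁₁))ᴴ = (-2 : ℂ) • (T.toBlocks₂₂ * Matrix.single b b x * Tinv.toBlocks₁₁) := by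
  rw [framedCornerIndex_eq_single_real T Tinv t ht hTdef hTinvdef b hx]
  exact conjTranspose_single_diag_of_im_eq_zero b (Complex.ofReal_im _)

/-- **`det = 0`** (`hdet0`): the framed corner index is singular (rank one in size two). [cite: Shimura1997, §18.1 (18.4)] -/
theorem framedCornerIndex_det_eq_zero (b : Fin 2) (x : ℂ) :
    ((-2 : ℂ) • (T.toBlocks₂₂ * Matrix.single b b x * Tinv.toBlocks₁₁)).det = 0 := by
  rw [framedIndex_single_of_shimuraFrame T Tinv t ht hTdef hTinvdef b x]
  exact det_single_diag_eq_zero b _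

/-- **`≠ 0`** (`hne`): the framed corner index of a non-zero corner value is non-zero (`sgn(t_b) ≠ 0`). [cite: Shimura1997, §18.1 (18.4)] -/
theorem framedCornerIndex_ne_zero (b : Fin 2) {x : ℂ} (hx0 : x ≠ 0) :
    (-2 : ℂ) • (T.toBlocks₂₂ * Matrix.single b b x * Tinv.toBlocks₁₁) ≠ 0 := by
  rw [framedIndex_single_of_shimuraFrame T Tinv t ht hTdef hTinvdef b x]
  exact single_diag_ne_zero b (mul_ne_zero (mul_ne_zero I_ne_zero (by exact_mod_cast div_ne_zero (ht b) (abs_ne_zero.2 (ht b)))) hx0)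

/-- **SEMIDEFINITE OF EITHER SIGN** (`hsd`): for `Re x = 0` the framed corner index is positive semidefinite or negative semidefinite (by the sign of `−sgn(t_b)·Im x`).
[cite: Shimura1982, §4 Thm. 4.2] [cite: Shimura1997, §18.1 (18.4)] -/
theorem framedCornerIndex_posSemidef_or_neg (b : Fin 2) {x : ℂ} (hx : x.re = 0) :
    ((-2 : ℂ) • (T.toBlocks₂₂ * Matrix.single b b x * Tinv.toBlocks₁₁)).PosSemidef ∨
      (-((-2 : ℂ) • (T.toBlocks₂₂ * Matrix.single b b x * Tinv.toBlocks₁₁))).PosSemidef := by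
  rw [framedCornerIndex_eq_single_real T Tinv t ht hTdef hTinvdef b hx]
  exact posSemidef_single_diag_or_neg b (Complex.ofReal_im _)

/-- the POSITIVE twin: `0 ≤ −sgn(t_b)·Im x ⟹` the framed corner index is positive semidefinite. [cite: Shimura1982, §4 Thm. 4.2] -/
theorem framedCornerIndex_posSemidef (b : Fin 2) {x : ℂ} (hx : x.re = 0) (hsgn : 0 ≤ -((t b / |t b|) * x.im)) :
    ((-2 : ℂ) • (T.toBlocks₂₂ * Matrix.single b b x * Tinv.toBlocks₁₁)).PosSemidef := by
  rw [framedCornerIndex_eq_single_real T Tinv t ht hTdef hTinvdef b hx]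
  exact posSemidef_single_diag_of_nonneg b (Complex.zero_le_real.2 hsgn)

/-- the NEGATIVE twin: `−sgn(t_b)·Im x ≤ 0 ⟹` minus the framed corner index is positive semidefinite. [cite: Shimura1982, §4 Thm. 4.2] -/
theorem framedCornerIndex_neg_posSemidef (b : Fin 2) {x : ℂ} (hx : x.re = 0) (hsgn : -((t b / |t b|) * x.im) ≤ 0) :
    (-((-2 : ℂ) • (T.toBlocks₂₂ * Matrix.single b b x * Tinv.toBlocks₁₁))).PosSemidef := by
  rw [framedCornerIndex_eq_single_real T Tinv t ht hTdef hTinvdef b hx, Matrix.single_neg, ← Complex.ofReal_neg]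
  exact posSemidef_single_diag_of_nonneg b (Complex.zero_le_real.2 (neg_nonneg.2 hsgn))

end Frame

/-! ## §3 At the frame of record, per complex place: the letters `hsd hdet0 hne hherm` keyed to ★ p864788 `hW1_scalarType_rankOne` -/

section Place

variable (L : Type) [Field L] [NumberField L] [IsCMField L] {N M : ℕ} (e : Fin N × Fin M ≃ Fin 2)
  (dV : Fin N → L) (hdV : ∀ i, IsCMField.complexConj L (dV i) = dV i)
  (dW : Fin M → L) (hdW : ∀ i, IsCMField.complexConj L (dW i) = dW i)
  (T Tinv : {w : InfinitePlace L // w.IsComplex} → Matrix (Fin 2 ⊕ Fin 2) (Fin 2 ⊕ Fin 2) ℂ)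
  (hTdef : ∀ w, T w = fromBlocks (diagonal (fun k => (Real.sqrt (|(w.1.embedding (dV (e.symm k).1 * dW (e.symm k).2)).re| / 2) : ℂ))) (diagonal (fun k => (Real.sqrt (|(w.1.embedding (dV (e.symm k).1 * dW (e.symm k).2)).re| / 2) : ℂ)))
    (diagonal (fun k => I * ((((w.1.embedding (dV (e.symm k).1 * dW (e.symm k).2)).re / |(w.1.embedding (dV (e.symm k).1 * dW (e.symm k).2)).re|) * Real.sqrt (|(w.1.embedding (dV (e.symm k).1 * dW (e.symm k).2)).re| / 2) : ℝ) : ℂ))) (-diagonal (fun k => I * ((((w.1.embedding (dV (e.symm k).1 * dW (e.symm k).2)).re / |(w.1.embedding (dV (e.symm k).1 * dW (e.symm k).2)).re|) * Real.sqrt (|(w.1.embedding (dV (e.symm k).1 * dW (e.symm k).2)).re| / 2) : ℝ) : ℂ))))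
  (hTinvdef : ∀ w, Tinv w = fromBlocks (diagonal (fun k => (((Real.sqrt (|(w.1.embedding (dV (e.symm k).1 * dW (e.symm k).2)).re| / 2))⁻¹ / 2 : ℝ) : ℂ))) (-diagonal (fun k => I * (((Real.sqrt (|(w.1.embedding (dV (e.symm k).1 * dW (e.symm k).2)).re| / 2))⁻¹ * ((w.1.embedding (dV (e.symm k).1 * dW (e.symm k).2)).re / |(w.1.embedding (dV (e.symm k).1 * dW (e.symm k).2)).re|) / 2 : ℝ) : ℂ)))
    (diagonal (fun k => (((Real.sqrt (|(w.1.embedding (dV (e.symm k).1 * dW (e.symm k).2)).re| / 2))⁻¹ / 2 : ℝ) : ℂ))) (diagonal (fun k => I * (((Real.sqrt (|(w.1.embedding (dV (e.symm k).1 * dW (e.symm k).2)).re| / 2))⁻¹ * ((w.1.embedding (dV (e.symm k).1 * dW (e.symm k).2)).re / |(w.1.embedding (dV (e.symm k).1 * dW (e.symm k).2)).re|) / 2 : ℝ) : ℂ))))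

include hdV hdW hTdef hTinvdef

/-- **THE EXPLICIT VALUE AT THE RECORD.**  For a skew corner value `σ` (`c σ = −σ`): `−2·(T_w)₂₂·σ_w(σ·E_bb)·(T_w⁻¹)₁₁ = (−sgn(t_b(w))·Im σ_w σ)·E_bb`,
`t_b(w) = Re σ_w(dV_{(e⁻¹b).1}·dW_{(e⁻¹b).2})` — the sign the (σ-A) road reads. [cite: Shimura1997, §18.1 (18.4)] [cite: Shimura1982, §4 Thm. 4.2] -/
theorem eq_single_of_frame (hdV0 : ∀ i, dV i ≠ 0) (hdW0 : ∀ j, dW j ≠ 0) {σ : L} (hσc : IsCMField.complexConj L σ = -σ) (b : Fin 2)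
    (w : {w : InfinitePlace L // w.IsComplex}) :
    (-2 : ℂ) • ((T w).toBlocks₂₂ * (Matrix.single b b σ).map w.1.embedding * (Tinv w).toBlocks₁₁) =
      Matrix.single b b ((-(((w.1.embedding (dV (e.symm b).1 * dW (e.symm b).2)).re / |(w.1.embedding (dV (e.symm b).1 * dW (e.symm b).2)).re|) *
        (w.1.embedding σ).im) : ℝ) : ℂ) := by
  have hw : IsCMField.complexConj L • w.1 = w.1 := UnitaryGroup.complexConj_smul_infinitePlace L w.1
  rw [Matrix.map_single]
  exact framedCornerIndex_eq_single_real (T w) (Tinv w) (fun k => (w.1.embedding (dV (e.symm k).1 * dW (e.symm k).2)).re)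
    (tw_ne_zero L e dV hdV dW hdW w hw hdV0 hdW0) (hTdef w) (hTinvdef w) b (re_embedding_eq_zero_of_complexConj_eq_neg w.1.embedding hσc)

/-- **`hherm`** at the record: the framed corner index of a skew corner value is hermitian. [cite: Shimura1997, §18.1 (18.4), §A3] -/
theorem hherm_of_frame (hdV0 : ∀ i, dV i ≠ 0) (hdW0 : ∀ j, dW j ≠ 0) {σ : L} (hσc : IsCMField.complexConj L σ = -σ) (b : Fin 2)
    (w : {w : InfinitePlace L // w.IsComplex}) :
    ((-2 : ℂ) • ((T w).toBlocks₂₂ * (Matrix.single b b σ).map w.1.embedding * (Tinv w).toBlocks₁₁))ᴴ =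
      (-2 : ℂ) • ((T w).toBlocks₂₂ * (Matrix.single b b σ).map w.1.embedding * (Tinv w).toBlocks₁₁) := by
  have hw : IsCMField.complexConj L • w.1 = w.1 := UnitaryGroup.complexConj_smul_infinitePlace L w.1
  rw [Matrix.map_single]
  exact framedCornerIndex_conjTranspose (T w) (Tinv w) (fun k => (w.1.embedding (dV (e.symm k).1 * dW (e.symm k).2)).re)
    (tw_ne_zero L e dV hdV dW hdW w hw hdV0 hdW0) (hTdef w) (hTinvdef w) b (re_embedding_eq_zero_of_complexConj_eq_neg w.1.embedding hσc)

/-- **`hdet0`** at the record (★ p864788's binder): the framed corner index is singular. [cite: Shimura1997, §18.1 (18.4)] -/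
theorem hdet0_of_frame (hdV0 : ∀ i, dV i ≠ 0) (hdW0 : ∀ j, dW j ≠ 0) (σ : L) (b : Fin 2) (w : {w : InfinitePlace L // w.IsComplex}) :
    ((-2 : ℂ) • ((T w).toBlocks₂₂ * (Matrix.single b b σ).map w.1.embedding * (Tinv w).toBlocks₁₁)).det = 0 := by
  have hw : IsCMField.complexConj L • w.1 = w.1 := UnitaryGroup.complexConj_smul_infinitePlace L w.1
  rw [Matrix.map_single]
  exact framedCornerIndex_det_eq_zero (T w) (Tinv w) (fun k => (w.1.embedding (dV (e.symm k).1 * dW (e.symm k).2)).re)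
    (tw_ne_zero L e dV hdV dW hdW w hw hdV0 hdW0) (hTdef w) (hTinvdef w) b _

/-- **`hne`** at the record (★ p864788's binder): the framed corner index of a non-zero corner value is non-zero (`σ_w` is injective). [cite: Shimura1997, §18.1 (18.4)] -/
theorem hne_of_frame (hdV0 : ∀ i, dV i ≠ 0) (hdW0 : ∀ j, dW j ≠ 0) {σ : L} (hσ0 : σ ≠ 0) (b : Fin 2) (w : {w : InfinitePlace L // w.IsComplex}) :
    (-2 : ℂ) • ((T w).toBlocks₂₂ * (Matrix.single b b σ).map w.1.embedding * (Tinv w).toBlocks₁₁) ≠ 0 := by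
  have hw : IsCMField.complexConj L • w.1 = w.1 := UnitaryGroup.complexConj_smul_infinitePlace L w.1
  rw [Matrix.map_single]
  exact framedCornerIndex_ne_zero (T w) (Tinv w) (fun k => (w.1.embedding (dV (e.symm k).1 * dW (e.symm k).2)).re)
    (tw_ne_zero L e dV hdV dW hdW w hw hdV0 hdW0) (hTdef w) (hTinvdef w) b ((map_ne_zero w.1.embedding).2 hσ0)

/-- **`hsd`** at the record (★ p864788's binder): the framed corner index of a skew corner value is positive semidefinite or negative semidefinite — so that
`hAloc := fun r hr w => hW1_scalarType_rankOne k (hx w) (hg w) (hsd_of_frame … w) (hdet0_of_frame … w) (hne_of_frame … w) (heb w)`.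
[cite: Shimura1982, §4 Thm. 4.2] [cite: Shimura1997, §18.1 (18.4)] -/
theorem hsd_of_frame (hdV0 : ∀ i, dV i ≠ 0) (hdW0 : ∀ j, dW j ≠ 0) {σ : L} (hσc : IsCMField.complexConj L σ = -σ) (b : Fin 2)
    (w : {w : InfinitePlace L // w.IsComplex}) :
    ((-2 : ℂ) • ((T w).toBlocks₂₂ * (Matrix.single b b σ).map w.1.embedding * (Tinv w).toBlocks₁₁)).PosSemidef ∨
      (-((-2 : ℂ) • ((T w).toBlocks₂₂ * (Matrix.single b b σ).map w.1.embedding * (Tinv w).toBlocks₁₁))).PosSemidef := by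
  have hw : IsCMField.complexConj L • w.1 = w.1 := UnitaryGroup.complexConj_smul_infinitePlace L w.1
  rw [Matrix.map_single]
  exact framedCornerIndex_posSemidef_or_neg (T w) (Tinv w) (fun k => (w.1.embedding (dV (e.symm k).1 * dW (e.symm k).2)).re)
    (tw_ne_zero L e dV hdV dW hdW w hw hdV0 hdW0) (hTdef w) (hTinvdef w) b (re_embedding_eq_zero_of_complexConj_eq_neg w.1.embedding hσc)

/-- the POSITIVE twin at the record: `0 ≤ −sgn(t_b(w))·Im σ_w σ ⟹` positive semidefinite. [cite: Shimura1982, §4 Thm. 4.2] -/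
theorem posSemidef_of_frame (hdV0 : ∀ i, dV i ≠ 0) (hdW0 : ∀ j, dW j ≠ 0) {σ : L} (hσc : IsCMField.complexConj L σ = -σ) (b : Fin 2)
    (w : {w : InfinitePlace L // w.IsComplex})
    (hsgn : 0 ≤ -(((w.1.embedding (dV (e.symm b).1 * dW (e.symm b).2)).re / |(w.1.embedding (dV (e.symm b).1 * dW (e.symm b).2)).re|) * (w.1.embedding σ).im)) :
    ((-2 : ℂ) • ((T w).toBlocks₂₂ * (Matrix.single b b σ).map w.1.embedding * (Tinv w).toBlocks₁₁)).PosSemidef := by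
  have hw : IsCMField.complexConj L • w.1 = w.1 := UnitaryGroup.complexConj_smul_infinitePlace L w.1
  rw [Matrix.map_single]
  exact framedCornerIndex_posSemidef (T w) (Tinv w) (fun k => (w.1.embedding (dV (e.symm k).1 * dW (e.symm k).2)).re)
    (tw_ne_zero L e dV hdV dW hdW w hw hdV0 hdW0) (hTdef w) (hTinvdef w) b (re_embedding_eq_zero_of_complexConj_eq_neg w.1.embedding hσc) hsgn

/-- the NEGATIVE twin at the record: `−sgn(t_b(w))·Im σ_w σ ≤ 0 ⟹` negative semidefinite. [cite: Shimura1982, §4 Thm. 4.2] -/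
theorem neg_posSemidef_of_frame (hdV0 : ∀ i, dV i ≠ 0) (hdW0 : ∀ j, dW j ≠ 0) {σ : L} (hσc : IsCMField.complexConj L σ = -σ) (b : Fin 2)
    (w : {w : InfinitePlace L // w.IsComplex})
    (hsgn : -(((w.1.embedding (dV (e.symm b).1 * dW (e.symm b).2)).re / |(w.1.embedding (dV (e.symm b).1 * dW (e.symm b).2)).re|) * (w.1.embedding σ).im) ≤ 0) :
    (-((-2 : ℂ) • ((T w).toBlocks₂₂ * (Matrix.single b b σ).map w.1.embedding * (Tinv w).toBlocks₁₁))).PosSemidef := by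
  have hw : IsCMField.complexConj L • w.1 = w.1 := UnitaryGroup.complexConj_smul_infinitePlace L w.1
  rw [Matrix.map_single]
  exact framedCornerIndex_neg_posSemidef (T w) (Tinv w) (fun k => (w.1.embedding (dV (e.symm k).1 * dW (e.symm k).2)).re)
    (tw_ne_zero L e dV hdV dW hdW w hw hdV0 hdW0) (hTdef w) (hTinvdef w) b (re_embedding_eq_zero_of_complexConj_eq_neg w.1.embedding hσc) hsgn

end Place

end Summit.HodgeConjecture.HodgeConjecture.Cruxes.HLiu418.K2LiuRankOneFramedCornerIndexLetters

end
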